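import Mathlib
import Summits.ValiantsHypothesis.ValiantsHypothesis.Theorems.FifoMatchingNNDivisionHardBlockNewtonDimension
import HarnessLib

/-!
# Route FifoMatching — crux `NNDivisionHard` (stmt-ValiantsHypothesis-21181): NEWTON DIMENSION OF A FIBRE — the general
# transport form (any product face `top_w NN_N = ι(NN_b) · S`, the dimension read on the `w`-initial form of the cofactor)

`…BlockNewtonDimension` (this hand) reads the Newton dimension of the WHOLE cofactor restricted to a block.  The abstract
linear transport of `…LinearTransport(Explicit)` is more generous: for ANY direction `w` in which the initial form of `NN_N`
splits as `top_w NN_N = ι(NN_b) · S` (`ι` an injective renaming of the arcs of `[0,2b)`, `S ≠ 0` off the range of `ι`), the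
certificate `(h, NN_N · h)` restricts to `(g, NN_b · g)` where the monomials of `g` are the `ι`-pull-backs of the monomials of
the INITIAL FORM `top_w h` only (`exists_face_transport_supp`).  Since `w` is free off the range of `ι` (e.g.
`w = B · 𝟙_L + w_off` with `w_off` supported on non-block arcs and `B` large: first the split face, then any further free
initial forms in non-block directions), the dimension that matters is that of ONE FIBRE of the cofactor's Newton polytope
over an extreme point of its off-block projection, not of the whole projection:

* ★ `exists_face_transport_supp` — transport along a product face with support control;
* ★★ `faceNewtonDim_not_certificate_qp` — **for every `c`, eventually in `N`: for every `b ≤ N`, every injective `ι`, every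
  `w, S` with `top_w NN_N = ι(NN_b) · S`, `S ≠ 0` supported off `range ι`, and every `h ≠ 0`: if the `ι`-pull-backs of the
  monomials of `top_w h` span an affine space of dimension `D` with `2 (D + 1) ((log₂ N + c + 19)^{6(c+19)} + 3) ≤ b`, then
  `2^((log₂ N + c)^c) < L₊(NN_N · h) + L₊(h)`;**  `faceNewtonDim_not_certificate_qp'` — the `∃ k` form
  (`(D + 1)(log₂ N)^k ≤ b`).

HONEST FRAMING: the general form of one rung toward ONE crux; the surviving cofactors have, for EVERY embedded product face
`ι(NN_b) · S` of `NN_N` with `b ≥ (log₂ N)^k`, a `w`-initial form whose block fibre has Newton dimension `≥ b/(log₂ N)^k`;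
stmt-21181 stays OPEN; nothing here bears on `NNNotVP` or on VP ≠ VNP (NOT proved).  No definitions, no named facts.
References: Bürgisser 2000 Rem. 2.7 [Burgisser2000]; Hrubeš–Yehudayoff 2021 §6 Problem 2 [HrubesYehudayoff2021].
-/

noncomputable section

-- Sub = Summit single-conjunct layout: the duplicated namespace component is mandated by the tree.
set_option linter.dupNamespace false
set_option autoImplicit false

namespace Summit.ValiantsHypothesis.ValiantsHypothesis.Theorems.FifoMatching.NNDivisionHard.FaceNewtonDimension

open Finset MvPolynomial Literature.Computability.AlgebraicComplexity
open Summit.ValiantsHypothesis.ValiantsHypothesis.Theorems.ZeroOneTransfer.Negative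
  (topComponent topComponent_ne_zero support_topComponent_subset)
open Summit.ValiantsHypothesis.ValiantsHypothesis.Theorems.FifoMatching.NNDivisionHard.LinearTransport
  (exists_linear_transport_eq)
open Summit.ValiantsHypothesis.ValiantsHypothesis.Theorems.FifoMatching.NNDivisionHard.NewtonDimension
  (complexity_face_le_of_newtonDim)
open Summit.ValiantsHypothesis.ValiantsHypothesis.Theorems.FifoMatching.NNDivisionHard.PolylogArcFaces
  (polylog_absorb)
open Summit.ValiantsHypothesis.ValiantsHypothesis.Theorems.FifoMatching.NNDivisionHard.BlockNewtonDimension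
  (exists_mem_support_of_rename_eq_aeval polylogArcFaces_qp_hard_scale two_pow_polylog_succ)
open scoped NNReal BigOperators

/-- ★ **TRANSPORT ALONG A PRODUCT FACE, WITH SUPPORT CONTROL.**  If `top_w NN_N = ι(NN_b) · S` with `ι` injective and
`S ≠ 0` supported off `range ι`, then every certificate `(h, NN_N · h)` restricts to `(g, NN_b · g)` with `g ≠ 0`,
`L₊(NN_b · g) ≤ L₊(NN_N · h) + 1`, `L₊(g) ≤ L₊(h)`, and every monomial of `g` the `ι`-pull-back of a monomial of `top_w h`.
[cite: Burgisser2000, Rem. 2.7] -/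
theorem exists_face_transport_supp {N b : ℕ} {ι : Fin (2 * b) × Fin (2 * b) → Fin (2 * N) × Fin (2 * N)}
    (hι : Function.Injective ι) (w : Fin (2 * N) × Fin (2 * N) → ℕ)
    {S : MvPolynomial (Fin (2 * N) × Fin (2 * N)) ℝ≥0}
    (hface : topComponent w (nestFreeMatchingPoly N ℝ≥0) = rename ι (nestFreeMatchingPoly b ℝ≥0) * S) (hS0 : S ≠ 0)
    (hS : ∀ m ∈ S.support, ∀ e ∈ m.support, e ∉ Set.range ι)
    {h : MvPolynomial (Fin (2 * N) × Fin (2 * N)) ℝ≥0} (hh : h ≠ 0) :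
    ∃ g : MvPolynomial (Fin (2 * b) × Fin (2 * b)) ℝ≥0, g ≠ 0 ∧
      complexity (nestFreeMatchingPoly b ℝ≥0 * g) ≤ complexity (nestFreeMatchingPoly N ℝ≥0 * h) + 1 ∧
      complexity g ≤ complexity h ∧
      ∀ d ∈ g.support, ∃ m ∈ (topComponent w h).support, ∀ t, d t = m (ι t) := by
  classical
  let a : Fin (2 * N) × Fin (2 * N) → MvPolynomial (Fin (2 * N) × Fin (2 * N)) ℝ≥0 :=
    fun e => if e ∈ Set.range ι then X e else 1
  have hK : ∀ e, e ∈ Set.range ι → a e = X e := fun e he => by simp only [a, if_pos he]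
  have hK' : ∀ e, e ∉ Set.range ι → a e = 1 := fun e he => by simp only [a, if_neg he]
  obtain ⟨g, hg0, h1, h2, hg⟩ := exists_linear_transport_eq hι w hface hS0 hS a hK hK' hh
  exact ⟨g, hg0, h1, h2, exists_mem_support_of_rename_eq_aeval hι a hK hK' hg⟩

/-- ★★ **NEWTON DIMENSION OF A FIBRE.**  For every `c`, eventually in `N`: for every `b ≤ N`, every product face
`top_w NN_N = ι(NN_b) · S` (`ι` injective, `S ≠ 0` off `range ι`) and every `h ≠ 0`, if the `ι`-pull-backs of the monomials
of `top_w h` span an affine space of dimension `D` with `2 (D + 1) ((log₂ N + c + 19)^{6(c+19)} + 3) ≤ b`, then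
`2^((log₂ N + c)^c) < L₊(NN_N · h) + L₊(h)`.
[cite: Burgisser2000, Rem. 2.7] [cite: HrubesYehudayoff2021, §6 Problem 2] [cite: JuknaSeiwertSergeev2022, Thm 1] -/
theorem faceNewtonDim_not_certificate_qp (c : ℕ) : ∃ n₀ : ℕ, ∀ N : ℕ, n₀ ≤ N → ∀ b : ℕ, b ≤ N →
    ∀ (ι : Fin (2 * b) × Fin (2 * b) → Fin (2 * N) × Fin (2 * N)), Function.Injective ι →
    ∀ (w : Fin (2 * N) × Fin (2 * N) → ℕ) (S : MvPolynomial (Fin (2 * N) × Fin (2 * N)) ℝ≥0),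
      topComponent w (nestFreeMatchingPoly N ℝ≥0) = rename ι (nestFreeMatchingPoly b ℝ≥0) * S → S ≠ 0 →
      (∀ m ∈ S.support, ∀ e ∈ m.support, e ∉ Set.range ι) →
    ∀ h : MvPolynomial (Fin (2 * N) × Fin (2 * N)) ℝ≥0, h ≠ 0 →
      2 * (Module.finrank ℚ (vectorSpan ℚ ((fun u : (Fin (2 * N) × Fin (2 * N)) →₀ ℕ =>
        fun t : Fin (2 * b) × Fin (2 * b) => (u (ι t) : ℚ)) ''
          ((topComponent w h).support : Set ((Fin (2 * N) × Fin (2 * N)) →₀ ℕ)))) + 1) *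
        ((Nat.log 2 N + (c + 1 + 18)) ^ (6 * (c + 1 + 18)) + 3) ≤ b →
      2 ^ ((Nat.log 2 N + c) ^ c) < complexity (nestFreeMatchingPoly N ℝ≥0 * h) + complexity h := by
  obtain ⟨n₀, hn₀⟩ := polylogArcFaces_qp_hard_scale (c + 1)
  refine ⟨max n₀ 2, fun N hN b hbN ι hι w S hface hS0 hS h hh hD => ?_⟩
  have hN2 : 2 ≤ N := le_trans (le_max_right _ _) hN
  obtain ⟨g, hg0, hg1, hg2, hgsupp⟩ := exists_face_transport_supp hι w hface hS0 hS hh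
  have hsub : ((fun u : (Fin (2 * b) × Fin (2 * b)) →₀ ℕ => fun a : Fin (2 * b) × Fin (2 * b) => (u a : ℚ)) ''
        (g.support : Set ((Fin (2 * b) × Fin (2 * b)) →₀ ℕ))) ⊆
      ((fun u : (Fin (2 * N) × Fin (2 * N)) →₀ ℕ => fun t : Fin (2 * b) × Fin (2 * b) => (u (ι t) : ℚ)) ''
          ((topComponent w h).support : Set ((Fin (2 * N) × Fin (2 * N)) →₀ ℕ))) := by
    rintro p ⟨d, hd, rfl⟩
    obtain ⟨m, hm, hdm⟩ := hgsupp d (Finset.mem_coe.1 hd)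
    refine ⟨m, Finset.mem_coe.2 hm, funext fun t => ?_⟩
    simp only [hdm t]
  have hdim := Submodule.finrank_mono (vectorSpan_mono ℚ hsub)
  have hb3 : 3 ≤ b := by
    have h6 : 2 * 1 * 3 ≤ 2 * (Module.finrank ℚ (vectorSpan ℚ
        ((fun u : (Fin (2 * N) × Fin (2 * N)) →₀ ℕ => fun t : Fin (2 * b) × Fin (2 * b) => (u (ι t) : ℚ)) ''
          ((topComponent w h).support : Set ((Fin (2 * N) × Fin (2 * N)) →₀ ℕ)))) + 1) *
        ((Nat.log 2 N + (c + 1 + 18)) ^ (6 * (c + 1 + 18)) + 3) :=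
      Nat.mul_le_mul (Nat.mul_le_mul_left 2 (Nat.le_add_left 1 _)) (Nat.le_add_left 3 _)
    omega
  obtain ⟨I, hIcard, -, hfaceI⟩ := complexity_face_le_of_newtonDim hb3 hg0
  have hID : I.card ≤ Module.finrank ℚ (vectorSpan ℚ
      ((fun u : (Fin (2 * N) × Fin (2 * N)) →₀ ℕ => fun t : Fin (2 * b) × Fin (2 * b) => (u (ι t) : ℚ)) ''
        ((topComponent w h).support : Set ((Fin (2 * N) × Fin (2 * N)) →₀ ℕ)))) := hIcard.trans hdim
  have hI : 2 * (I.card + 1) * ((Nat.log 2 N + (c + 1 + 18)) ^ (6 * (c + 1 + 18)) + 3) ≤ b :=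
    le_trans (Nat.mul_le_mul_right _ (Nat.mul_le_mul_left 2 (Nat.add_le_add_right hID 1))) hD
  have hface' : complexity (∑ M ∈ (nestFreeMatchings (2 * b)).filter (fun M => ∀ j ∈ openers M, (j, M j) ∉ I),
      arcMonomial ℝ≥0 M) ≤
      16 * ((2 * b + 1) * ((complexity (nestFreeMatchingPoly N ℝ≥0 * h) + 1) + 2)) ^ 2 := by
    refine hfaceI.trans (Nat.mul_le_mul_left 16 (Nat.pow_le_pow_left (Nat.mul_le_mul_left _ ?_) 2))
    exact Nat.add_le_add_right hg1 2
  have H := hn₀ N (le_trans (le_max_left _ _) hN) b hbN I hI _ hface'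
  have hℓ : 1 ≤ Nat.log 2 N := (Nat.le_log_iff_pow_le one_lt_two (by omega)).2 (by rw [pow_one]; exact hN2)
  have hsucc := two_pow_polylog_succ (Nat.log 2 N) c hℓ
  have hpos : complexity (nestFreeMatchingPoly N ℝ≥0 * h) ≤
      complexity (nestFreeMatchingPoly N ℝ≥0 * h) + complexity h := Nat.le_add_right _ _
  omega

/-- ★★ **The same, `∃ k` form** (`(D + 1)(log₂ N)^k ≤ b`). [cite: HrubesYehudayoff2021, §6 Problem 2] -/
theorem faceNewtonDim_not_certificate_qp' (c : ℕ) : ∃ k n₀ : ℕ, ∀ N : ℕ, n₀ ≤ N → ∀ b : ℕ, b ≤ N →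
    ∀ (ι : Fin (2 * b) × Fin (2 * b) → Fin (2 * N) × Fin (2 * N)), Function.Injective ι →
    ∀ (w : Fin (2 * N) × Fin (2 * N) → ℕ) (S : MvPolynomial (Fin (2 * N) × Fin (2 * N)) ℝ≥0),
      topComponent w (nestFreeMatchingPoly N ℝ≥0) = rename ι (nestFreeMatchingPoly b ℝ≥0) * S → S ≠ 0 →
      (∀ m ∈ S.support, ∀ e ∈ m.support, e ∉ Set.range ι) →
    ∀ h : MvPolynomial (Fin (2 * N) × Fin (2 * N)) ℝ≥0, h ≠ 0 →
      (Module.finrank ℚ (vectorSpan ℚ ((fun u : (Fin (2 * N) × Fin (2 * N)) →₀ ℕ =>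
        fun t : Fin (2 * b) × Fin (2 * b) => (u (ι t) : ℚ)) ''
          ((topComponent w h).support : Set ((Fin (2 * N) × Fin (2 * N)) →₀ ℕ)))) + 1) * (Nat.log 2 N) ^ k ≤ b →
      2 ^ ((Nat.log 2 N + c) ^ c) < complexity (nestFreeMatchingPoly N ℝ≥0 * h) + complexity h := by
  obtain ⟨n₀, hn₀⟩ := faceNewtonDim_not_certificate_qp c
  obtain ⟨l₀, hl₀⟩ := polylog_absorb (c + 1)
  refine ⟨6 * (c + 1 + 18) + 1, max n₀ (2 ^ l₀), fun N hN b hbN ι hι w S hface hS0 hS h hh hD =>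
    hn₀ N (le_trans (le_max_left _ _) hN) b hbN ι hι w S hface hS0 hS h hh ?_⟩
  have hN' : 2 ^ l₀ ≤ N := le_trans (le_max_right _ _) hN
  have hl : l₀ ≤ Nat.log 2 N :=
    (Nat.le_log_iff_pow_le one_lt_two (by have := Nat.one_le_two_pow (n := l₀); omega)).2 hN'
  set D := Module.finrank ℚ (vectorSpan ℚ ((fun u : (Fin (2 * N) × Fin (2 * N)) →₀ ℕ =>
        fun t : Fin (2 * b) × Fin (2 * b) => (u (ι t) : ℚ)) ''
          ((topComponent w h).support : Set ((Fin (2 * N) × Fin (2 * N)) →₀ ℕ)))) with hDdef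
  calc 2 * (D + 1) * ((Nat.log 2 N + (c + 1 + 18)) ^ (6 * (c + 1 + 18)) + 3)
      = (D + 1) * (2 * ((Nat.log 2 N + (c + 1 + 18)) ^ (6 * (c + 1 + 18)) + 3)) := by
        rw [Nat.mul_comm 2 (D + 1), Nat.mul_assoc]
    _ ≤ (D + 1) * (Nat.log 2 N) ^ (6 * (c + 1 + 18) + 1) := Nat.mul_le_mul_left _ (hl₀ _ hl)
    _ ≤ b := hD

end Summit.ValiantsHypothesis.ValiantsHypothesis.Theorems.FifoMatching.NNDivisionHard.FaceNewtonDimension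

end
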